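import Summits.AtomisticToContinuum.Crystallization.Theorems.FrustratedLawDichotomyStrainedPatchHomPrunedPolar

/-!
# Coordinate bounds for the COVER ROOT of the `(H)` certificate
# (27623 strained-patch piece; decomp-a2c, prover hand 2, generation 20; pre-(g3): whatever box coordinates lens-5 fixes, the root box must
# provably contain the parameter set)

`homFloor_of_prunedBoxSums_selfAdjoint` (p842952) quantifies over self-adjoint positive `U : E3 →L[ℝ] E3` with `‖U − 1‖ ≤ 1/4` and shuffles
`‖ξ‖ ≤ 1/4`.  A box certificate quantifies over COORDINATES.  This DEF-FREE module supplies the root inclusions: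

* `coord_mem_cube_of_norm_le`: `‖x‖ ≤ r ⟹ x ∈ [−r, r]³` on `E3` (so `‖ξ‖ ≤ 1/4 ⟹ ξ ∈ [−1/4, 1/4]³`);
* `abs_entry_sub_le_of_near_one`: `‖G − 1‖ ≤ ε ⟹ |G_ij − δ_ij| ≤ ε` for the matrix entries `G_ij = (G e_j) i` (so every admissible `U` lies in the
  entry box `Π_ij [δ_ij − 1/4, δ_ij + 1/4]`; `entry_mem_box_of_near_one`, diagonal / off-diagonal forms);
* `apply_eq_sum_entries`: `(G v) i = Σ_j G_ij · v j` — the action of `G` on any vector from its nine entries (how a leaf evaluates `latPt U f b`).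

0 sorry; no definitions; axioms ⊆ {propext, Classical.choice, Quot.sound}.  `--supports stmt-AtomisticToContinuum-27623`.
-/

noncomputable section

namespace Summit.AtomisticToContinuum.Crystallization.Theorems.FrustratedLawDichotomyStrainedPatchHomCoords

open scoped BigOperators Classical
open Summit.AtomisticToContinuum.Crystallization.Theorems.ChargedEnergyGapNegative (E3)

/-- ★ **A norm bound is a coordinate cube**: `‖x‖ ≤ r ⟹ x ∈ [−r, r]³` on Euclidean `ℝ³` (the shuffle cover's root: `‖ξ‖ ≤ 1/4 ⟹ ξ ∈ [−1/4, 1/4]³`;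
the coordinate bound `|x i| ≤ ‖x‖` itself is `Literature…abs_apply_le_norm_E3`, re-derived inline to keep the import light). [folklore] -/
theorem coord_mem_cube_of_norm_le {x : E3} {r : ℝ} (hx : ‖x‖ ≤ r) (i : Fin 3) : -r ≤ x i ∧ x i ≤ r := by
  have h : (x i) ^ 2 ≤ ‖x‖ ^ 2 := by
    rw [EuclideanSpace.norm_sq_eq]
    have := Finset.single_le_sum (f := fun j : Fin 3 => ‖x j‖ ^ 2) (fun j _ => sq_nonneg _) (Finset.mem_univ i)
    simpa [Real.norm_eq_abs, sq_abs] using this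
  exact abs_le.1 ((abs_le_of_sq_le_sq h (norm_nonneg _)).trans hx)

/-- ★ **`‖G − 1‖ ≤ ε ⟹ |G_ij − δ_ij| ≤ ε`** for the entries `G_ij = (G e_j) i`, `e_j = EuclideanSpace.single j 1`. [folklore] -/
theorem abs_entry_sub_le_of_near_one {G : E3 →L[ℝ] E3} {ε : ℝ} (hG : ‖G - 1‖ ≤ ε) (i j : Fin 3) :
    |(G (EuclideanSpace.single j (1 : ℝ))) i - (if i = j then (1 : ℝ) else 0)| ≤ ε := by
  have h1 : ‖(G - 1) (EuclideanSpace.single j (1 : ℝ))‖ ≤ ε := by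
    calc ‖(G - 1) (EuclideanSpace.single j (1 : ℝ))‖ ≤ ‖G - 1‖ * ‖EuclideanSpace.single j (1 : ℝ)‖ := (G - 1).le_opNorm _
      _ = ‖G - 1‖ := by simp
      _ ≤ ε := hG
  have h2 := abs_le.2 (coord_mem_cube_of_norm_le h1 i)
  have h3 : ((G - 1) (EuclideanSpace.single j (1 : ℝ))) i = (G (EuclideanSpace.single j (1 : ℝ))) i - (if i = j then (1 : ℝ) else 0) := by
    simp [PiLp.single_apply]
  rwa [h3] at h2

/-- ★ **Entry box of the cover root**: every `G` with `‖G − 1‖ ≤ ε` has diagonal entries in `[1 − ε, 1 + ε]` and off-diagonal entries in `[−ε, ε]`. [folklore] -/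
theorem entry_mem_box_of_near_one {G : E3 →L[ℝ] E3} {ε : ℝ} (hG : ‖G - 1‖ ≤ ε) (i j : Fin 3) :
    (if i = j then (1 : ℝ) else 0) - ε ≤ (G (EuclideanSpace.single j (1 : ℝ))) i ∧
      (G (EuclideanSpace.single j (1 : ℝ))) i ≤ (if i = j then (1 : ℝ) else 0) + ε := by
  have h := abs_le.1 (abs_entry_sub_le_of_near_one hG i j)
  constructor <;> linarith [h.1, h.2]

/-- Diagonal form: `1 − ε ≤ G_jj ≤ 1 + ε`. [folklore] -/
theorem diag_entry_mem_of_near_one {G : E3 →L[ℝ] E3} {ε : ℝ} (hG : ‖G - 1‖ ≤ ε) (j : Fin 3) :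
    1 - ε ≤ (G (EuclideanSpace.single j (1 : ℝ))) j ∧ (G (EuclideanSpace.single j (1 : ℝ))) j ≤ 1 + ε := by
  simpa using entry_mem_box_of_near_one hG j j

/-- Off-diagonal form: `−ε ≤ G_ij ≤ ε` (`i ≠ j`). [folklore] -/
theorem offDiag_entry_mem_of_near_one {G : E3 →L[ℝ] E3} {ε : ℝ} (hG : ‖G - 1‖ ≤ ε) {i j : Fin 3} (hij : i ≠ j) :
    -ε ≤ (G (EuclideanSpace.single j (1 : ℝ))) i ∧ (G (EuclideanSpace.single j (1 : ℝ))) i ≤ ε := by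
  simpa [hij] using entry_mem_box_of_near_one hG i j

/-- ★ **The action from the entries**: `(G v) i = Σ_j G_ij · v j` — a leaf evaluates `latPt U f b` from the nine box coordinates. [folklore] -/
theorem apply_eq_sum_entries (G : E3 →L[ℝ] E3) (v : E3) (i : Fin 3) :
    (G v) i = ∑ j : Fin 3, (G (EuclideanSpace.single j (1 : ℝ))) i * v j := by
  have hv : v = ∑ j : Fin 3, v j • EuclideanSpace.single j (1 : ℝ) := by
    ext k
    fin_cases k <;> simp [Fin.sum_univ_three]
  have hGv : G v = ∑ j : Fin 3, v j • G (EuclideanSpace.single j (1 : ℝ)) := by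
    conv_lhs => rw [hv]
    simp [map_sum, map_smul]
  have key : ∀ w : E3, w i = inner ℝ (EuclideanSpace.single i (1 : ℝ)) w := fun w => by
    rw [EuclideanSpace.inner_single_left]; simp
  rw [key, hGv, inner_sum]
  refine Finset.sum_congr rfl fun j _ => ?_
  rw [inner_smul_right, ← key (G (EuclideanSpace.single j 1)), mul_comm]

end Summit.AtomisticToContinuum.Crystallization.Theorems.FrustratedLawDichotomyStrainedPatchHomCoords

end
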